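import Summits.ValiantsHypothesis.ValiantsHypothesis.Theses.PrincipalMinorColouring
import Literature.Computability.AlgebraicComplexity.PrincipalMinorRepr
import Literature.Computability.AlgebraicComplexity.SecondFundamentalTheoremGL
import Literature.Computability.AlgebraicComplexity.LRPencilOfMatrix

/-!
# Route PrincipalMinorColouring — `NormalForm` (Sylvester / Weinstein–Aronszajn normal form)

Item `stmt-ValiantsHypothesis-3779` of route `ValiantsHypothesis/PrincipalMinorColouring`:
an affine determinantal representation `A = A₀ + Σ_e x_e A_e` of `per_n` of any size `m` yields,
after the shift `x ↦ x + J` (`per_n(J) = n! ≠ 0`, so `B := A(J)` is invertible), one square matrix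
`K ∈ ℂ^{R×R}` and a colouring `κ : [R] → [n]²` with
`per_n(x + J) = n! · det(1 + diag(x_{κ(1)}, …, x_{κ(R)}) · K)` and `R ≤ Σ_e rank A_e`.

Proof: write `A_e = U_e W_e` (rank factorisation through `ℂ^{rank A_e}`,
`exists_eq_mul_of_rank_le`), stack the `U_e` into `U : m × R` and the `W_e` into `W : R × m`
indexed by `ι = Σ e, Fin (rank A_e)`, so that `Σ_e x_e A_e = U · diag(x ∘ κ) · W`; then
`det (B + U D W) = det B · det(1 + B⁻¹ U · D W) = det B · det(1 + D · W B⁻¹ U)` by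
`Matrix.det_one_add_mul_comm`, and `K := W B⁻¹ U`.

## Contents

* `det_add_linearPart_eq` — the Sylvester step for `B + Σ_e x_e A_e` with `det B` a unit
  (any field, any finite variable set).
* `map_aeval_X_add_one_eq` — the shift `x ↦ x + J` of a matrix of affine entries.
* `normalForm_proof : NormalForm` — the route item.
-/

namespace Summit.ValiantsHypothesis.Theorems.PrincipalMinorColouring

open MvPolynomial Matrix
open Literature.Computability.AlgebraicComplexity

section SylvesterStep

variable {k : Type*} [Field k] {σ : Type*} [Fintype σ] [DecidableEq σ]

/-- **Sylvester / Weinstein–Aronszajn step.** For a constant matrix `B` with `det B` a unit and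
constant coefficient matrices `Ae e` (`e : σ`), the affine matrix `B + Σ_e x_e · Ae e` has
determinant `det B · det(1 + diag(x ∘ κ) · K)` for some `K` of size `R ≤ Σ_e rank (Ae e)` and
some colouring `κ : Fin R → σ` (rank-factor each `Ae e`, pull out `B`, and commute the two
rectangular factors with `Matrix.det_one_add_mul_comm`). [folklore] -/
theorem det_add_linearPart_eq {m : ℕ} (B : Matrix (Fin m) (Fin m) k) (hB : IsUnit B.det)
    (Ae : σ → Matrix (Fin m) (Fin m) k) :
    ∃ R ≤ ∑ e, (Ae e).rank, ∃ (K : Matrix (Fin R) (Fin R) k) (κ : Fin R → σ),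
      (B.map C + Matrix.of (fun i j => ∑ e, C (Ae e i j) * X e) :
          Matrix (Fin m) (Fin m) (MvPolynomial σ k)).det
        = C B.det * (1 + Matrix.diagonal (fun i => X (κ i)) * K.map C).det := by
  classical
  -- rank factorisations `Ae e = U e * W e` through `k^{rank (Ae e)}`
  choose U W hUW using fun e => exists_eq_mul_of_rank_le (Ae e) le_rfl
  -- stack them along `ι = Σ e, Fin (rank (Ae e))`
  let ι : Type _ := Σ e : σ, Fin (Ae e).rank
  let bigU : Matrix (Fin m) ι k := Matrix.of fun i p => U p.1 i p.2
  let bigW : Matrix ι (Fin m) k := Matrix.of fun p j => W p.1 p.2 j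
  let D : Matrix ι ι (MvPolynomial σ k) := Matrix.diagonal fun p => X p.1
  have hL : (Matrix.of (fun i j => ∑ e, C (Ae e i j) * X e) :
      Matrix (Fin m) (Fin m) (MvPolynomial σ k)) =
        bigU.map (C (σ := σ)) * D * bigW.map (C (σ := σ)) := by
    refine Matrix.ext fun i j => ?_
    rw [Matrix.mul_apply, Matrix.of_apply]
    simp only [D, Matrix.mul_diagonal, Matrix.map_apply, bigU, bigW, Matrix.of_apply]
    rw [Fintype.sum_sigma]
    refine Finset.sum_congr rfl fun e _ => ?_
    have h1 : Ae e i j = ∑ t, U e i t * W e t j := by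
      rw [congrFun (congrFun (hUW e) i) j, Matrix.mul_apply]
    rw [h1, map_sum, Finset.sum_mul]
    refine Finset.sum_congr rfl fun t _ => ?_
    rw [map_mul]
    ring
  -- the inverse of `B`
  have hBinv : B * B⁻¹ = 1 := Matrix.mul_nonsing_inv B hB
  have hfactor : B.map (C (σ := σ)) + bigU.map (C (σ := σ)) * D * bigW.map (C (σ := σ))
      = B.map (C (σ := σ)) * (1 + (B⁻¹.map (C (σ := σ)) * bigU.map (C (σ := σ))) *
          (D * bigW.map (C (σ := σ)))) := by
    rw [Matrix.mul_add, Matrix.mul_one, ← Matrix.mul_assoc, ← Matrix.mul_assoc (B.map C),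
      ← Matrix.map_mul, hBinv, Matrix.map_one C C.map_zero C.map_one, Matrix.one_mul,
      Matrix.mul_assoc]
  let K' : Matrix ι ι k := bigW * B⁻¹ * bigU
  let eι : ι ≃ Fin (Fintype.card ι) := Fintype.equivFin ι
  refine ⟨Fintype.card ι, ?_, Matrix.reindex eι eι K', fun i => (eι.symm i).1, ?_⟩
  · simp only [ι, Fintype.card_sigma, Fintype.card_fin, le_refl]
  have hre : (1 + Matrix.diagonal (fun i => (X (eι.symm i).1 : MvPolynomial σ k)) *
      (Matrix.reindex eι eι K').map C) =
        Matrix.reindex eι eι (1 + Matrix.diagonal (fun p : ι => X p.1) * K'.map C) := by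
    rw [reindex_one_add_diagonal_mul]
    rfl
  rw [hre, Matrix.det_reindex_self, hL, hfactor, Matrix.det_mul, Matrix.det_one_add_mul_comm,
    RingHom.map_det, RingHom.mapMatrix_apply]
  congr 3
  simp only [K', D, Matrix.map_mul, Matrix.mul_assoc]

end SylvesterStep

section Shift

variable {k : Type*} [CommRing k] {σ : Type*} [Fintype σ] {ι : Type*}

/-- **The shift `x ↦ x + J`** of a matrix of affine entries `A = A₀ + Σ_e x_e A_e`:
`A(x + J) = B + Σ_e x_e A_e` with the constant matrix `B = A(J) = A₀ + Σ_e A_e`. [folklore] -/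
theorem map_aeval_X_add_one_eq (A : Matrix ι ι (MvPolynomial σ k))
    (hA : ∀ i j, (A i j).totalDegree ≤ 1) :
    A.map (aeval fun e : σ => (X e + 1 : MvPolynomial σ k)) =
      (Matrix.of fun i j => coeff 0 (A i j) + ∑ e, coeff (Finsupp.single e 1) (A i j)).map C
        + Matrix.of fun i j => ∑ e, C ((Matrix.of fun i j => coeff (Finsupp.single e 1) (A i j) :
            Matrix ι ι k) i j) * X e := by
  refine Matrix.ext fun i j => ?_
  simp only [Matrix.map_apply, Matrix.add_apply, Matrix.of_apply]
  conv_lhs => rw [LRPencil.eq_affine_of_totalDegree_le_one (A i j) (hA i j)]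
  simp only [map_add, map_sum, map_mul, aeval_C, aeval_X, algebraMap_eq, mul_add, mul_one,
    Finset.sum_add_distrib]
  ring

/-- The constant term of the shifted matrix is `B = A(J)`. [folklore] -/
theorem map_constantCoeff_shift (B : Matrix ι ι k) (Ae : σ → Matrix ι ι k) :
    ((B.map C + Matrix.of (fun i j => ∑ e, C (Ae e i j) * X e) :
        Matrix ι ι (MvPolynomial σ k)).map constantCoeff) = B := by
  refine Matrix.ext fun i j => ?_
  simp [constantCoeff_C, constantCoeff_X]

omit [Fintype σ] in
/-- `(aeval (x ↦ x + 1) p)(0) = p(1, …, 1)`. [folklore] -/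
theorem constantCoeff_aeval_X_add_one (p : MvPolynomial σ k) :
    constantCoeff (aeval (fun e : σ => (X e + 1 : MvPolynomial σ k)) p) =
      eval (fun _ => (1 : k)) p := by
  have h : (constantCoeff.comp
      (aeval fun e : σ => (X e + 1 : MvPolynomial σ k)).toRingHom) = eval (fun _ => (1 : k)) := by
    refine MvPolynomial.ringHom_ext (fun r => ?_) (fun e => ?_)
    · simp
    · simp
  exact RingHom.congr_fun h p

end Shift

/-- `per_n(1, …, 1) = n!` (the permanent of the all-ones matrix counts permutations). [folklore] -/
theorem eval_one_perPoly (n : ℕ) :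
    eval (fun _ => (1 : ℂ)) (perPoly (Fin n) ℂ) = (n.factorial : ℂ) := by
  rw [eval_perPoly]
  simp [Matrix.permanent, Fintype.card_perm]

/-- **Route item `NormalForm` (stmt-ValiantsHypothesis-3779), PROVED.** An affine determinantal
representation `A` of `per_n` of size `m` yields `K ∈ ℂ^{R×R}` and `κ : Fin R → Fin n × Fin n` with
`per_n(x + J) = n! · det(1 + diag(x ∘ κ) · K)` and `R ≤ Σ_e rank A_e`, `A_e` the coefficient matrix
of `x_e` in `A`: shift to `J` (`map_aeval_X_add_one_eq`; `det A(J) = per_n(J) = n! ≠ 0`), then the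
Sylvester step `det_add_linearPart_eq`. [folklore] -/
theorem normalForm_proof :
    Summit.ValiantsHypothesis.ValiantsHypothesis.Theses.PrincipalMinorColouring.NormalForm := by
  intro n m A hA
  obtain ⟨haff, hdet⟩ := hA
  -- the shifted matrix `A(x + J) = B + Σ_e x_e A_e`
  have hshift := map_aeval_X_add_one_eq A haff
  set B : Matrix (Fin m) (Fin m) ℂ :=
    Matrix.of fun i j => coeff 0 (A i j) + ∑ e, coeff (Finsupp.single e 1) (A i j) with hBdef
  set Ae : Fin n × Fin n → Matrix (Fin m) (Fin m) ℂ :=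
    fun e => Matrix.of fun i j => coeff (Finsupp.single e 1) (A i j) with hAedef
  have hdet' : aeval (fun e : Fin n × Fin n => (X e + 1 : MvPolynomial (Fin n × Fin n) ℂ))
      (perPoly (Fin n) ℂ) =
      (B.map C + Matrix.of (fun i j => ∑ e, C (Ae e i j) * X e) :
        Matrix (Fin m) (Fin m) (MvPolynomial (Fin n × Fin n) ℂ)).det := by
    rw [← hdet, AlgHom.map_det, AlgHom.mapMatrix_apply, hshift]
  -- `det B = per_n(J) = n!`
  have hBdet : B.det = (n.factorial : ℂ) := by
    have h := congrArg constantCoeff hdet'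
    rw [constantCoeff_aeval_X_add_one, eval_one_perPoly, RingHom.map_det, RingHom.mapMatrix_apply,
      map_constantCoeff_shift] at h
    exact h.symm
  have hBunit : IsUnit B.det := by
    rw [hBdet, isUnit_iff_ne_zero, Nat.cast_ne_zero]
    exact Nat.factorial_ne_zero n
  obtain ⟨R, hR, K, κ, hK⟩ := det_add_linearPart_eq B hBunit Ae
  refine ⟨R, hR, K, κ, ?_⟩
  rw [hdet', hK, hBdet]

end Summit.ValiantsHypothesis.Theorems.PrincipalMinorColouring
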